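import Literature.IUT.HodgeTheaters.PiAvatarBaseKitThetaNF
import Literature.IUT.HodgeTheaters.PiAvatarNFKit
import HarnessLib

/-!
# D-JΘ1-2 (D): THE NF-SIDE KIT `NFKit` OF [IUTchI] §4 RE-RUN OVER THE NF-WIDENED TRANSPORTER-OR-DEGENERATE AMBIENT —
# `nfKitThetaOfData … : (baseKitThetaNFOfData …).NFKit` (abc-iut-L5-t3's `nfKitOfData` p451329 transported along abc-iut-L5-t4's `π`/`ι`;
# one def + definitional readings — post-freeze additive, not a cone member)

S. Mochizuki, *Inter-universal Teichmüller theory I*, kurims manuscript (May 2020), Def 4.1 (v)(vi) pp. 97–98 («†𝒟^⊚»; the morphisms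
`†𝒟_v → †𝒟^⊚`), Ex 4.3 (i)–(iii) pp. 98–100 (`φ^NF_{•,v̲}`, «`Aut(C_K)/Aut_ε(C_K) ⥲ 𝔽_l^⋇`»), Ex 4.5 (i)(ii) pp. 107–108 (the induced isomorphisms
of `𝔽_l^⋇`-torsors `LabCusp(†𝒟^⊚) ⥲ LabCusp(†𝒟_v̲)`), Def 6.1 (v) p. 158 (the double covering `𝒟^{⊚±} → 𝒟^⊚`). ([IUTchI] Def 4.1 (v) p.97)
[claim: Mochizuki2012, status: disputed] (D-0012 claim key, series status DISPUTED — a construction over abc-iut-L5-t2's REAL `InitialThetaData`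
and abc-iut-L5-t4's `LocalDatum`; nothing of the series is asserted; no side is taken on [IUTchIII] Cor. 3.12).

## What this file builds (L5-lead RULINGS #86 (1)(D) / #87 (2)(b) / #88; D-JΘ1-2 wave (A) → (B),(B′),(D) → (C))

abc-iut-L5-t4's `baseKitThetaNFOfData CG hS hsurj bad arc δ` (`PiAvatarBaseKitThetaNF`) is the J-NF-1 base kit `baseKitNFOfData` (p450158) with
`Amb v := ThetaAmb D.augGF (δ v).InPlayNF` (`PiAvatarThetaAmb` p462621: morphisms = transport datum + outer hom + étale/degenerate tag; the étale
inclusion `ιThetaNF` and the transport projection `πThetaNF`, `ι ⋙ π = 𝟭`).  Here the NF-side kit `PMBaseKit.NFKit` (`KitNFSide`) is assembled over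
it with EVERY FIELD = the corresponding field of `nfKitOfData` (p451329) transported along `ι`/`π`:
* `nfAtV v := (δ v).nfAtVNF ⋙ ιThetaNF` (an isomorph `†𝒟^⊚` seen at `v̲`), `projAt v := ιThetaNF.map projAtNF` (the double covering seen at `v̲`),
  `phiNF v := ιThetaNF.map phiNFNF` (`φ^NF_{•,v̲} : xΠ_v̲ ↦ xΠ_{C̲_K}`), `phiNF_eq` by functoriality of `ι` from `phiNFNF_eq`;
* `Val`, `valOfV`, `GLabNF := 𝔽_l^⋇`, `gLabNFMap := gLabNFMapSlot`, `εLab := 1`, `exists_aut_smul` (⇐ `hNF : Surjective toFlStarNF`), `LabStar := 𝔽_l^⋇`,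
  `ηStar := 1` — VERBATIM as in `nfKitOfData` (these slots do not see the ambient);
* **`labPull f := (δ v).labPullAmb (πThetaNF.map f).hom`** — the label pull-back of an ARBITRARY morphism `X ⟶ †𝒟^⊚` of the Θ-ambient READS ONLY ITS
  TRANSPORT DATUM (a coset map), exactly as the Θ-kit's `labOfHom` does (abc-iut-L5-t4's design F2, memo `STEP0-ThetaAmb-ivb-g5.md` §3); the four laws
  `labPull_smul/_pre/_post/_phiNF_εLab` are abc-iut-L5-t3's `labPullAmb_smul/_pre/_post/_phiNFAmb_one` (p450993) composed with `π` (functoriality of `π`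
  is definitional on `ThetaAmb`).
Then the definitional readings `nfKitThetaOfData_GlobNF/_nfAtV_obj/_phiNF/_projAt/_GLabNF/_εLab/_labPull_apply/_labPull_ι`, and
`nonempty_nfKit_baseKitThetaNFOfData`.  PRICE IN FAITHFULNESS (recorded, as in (A)): on a DEGENERATE morphism `X ⟶ †𝒟^⊚` the label pull-back is
that of the transport datum it carries — extra-print bookkeeping invisible to the outer-hom functor `σ`; print's `φ^NF`-type morphisms are étale
(coset maps), on which `labPull` is the landed J-NF-1 value.  Binders: those of `baseKitThetaNFOfData` + `hNF` + `vemb` (as `nfKitOfData`); none added.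
No instance, no notation, no Prop fact; typed ≠ inhabited ≠ proved; binder ≠ fact.
-/

noncomputable section

namespace Literature.IUT.HodgeTheaters

open CategoryTheory

universe u v w

section NFKitTheta

variable {F : Type u} {K : Type v} {Fbar : Type w} [Field F] [NumberField F] [Field K] [NumberField K]
  [Algebra F K] [Field Fbar] [Algebra F Fbar] [Algebra K Fbar]
  {E : WeierstrassCurve F} [E.IsElliptic] {l : ℕ} {Pb : BadPlacePredicates K}
  (D : InitialThetaData F K Fbar E l Pb) (CG : D.geom.pe.CuspGalois) (hS : D.CuspClassesNormaliserStable) [Fact l.Prime]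

namespace InitialThetaData

namespace LocalDatum

variable {D CG hS} (δ : D.LocalDatum CG hS)

/-- An object of the NF-widened Θ-ambient isomorphic to `ι(𝒟_v̲)` has underlying Π-ambient object isomorphic to `ℬ(Π_v̲)⁰` (isomorphisms of
`ThetaAmb` are étale). ([IUTchI] Def 4.1 (i) p.95) [claim: Mochizuki2012, status: disputed] -/
theorem nonempty_iso_locObj_of_nonempty_iso_modelThetaNF {X : δ.AmbThetaNF} (hX : Nonempty (X ≅ δ.modelThetaNF)) :
    Nonempty (X.toFull.obj ≅ δ.locObj) :=
  δ.nonempty_iso_locObj_of_nonempty_iso_modelNF ((δ.nonempty_iso_modelThetaNF_iff X).mp hX)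

/-- `π` is the identity on étale morphisms: `π (ι f) = f` (definitional). ([IUTchI] §0 p.33) [claim: Mochizuki2012, status: disputed] -/
theorem πThetaNF_map_ιThetaNF_map {X Y : δ.AmbNF} (f : X ⟶ Y) : δ.πThetaNF.map (δ.ιThetaNF.map f) = f := rfl

end LocalDatum

/-! ### The NF kit over a `δ`-family, Θ-ambient version -/

section OfData

variable [(D.PiXund.subgroupOf D.PiXK).Normal] (hsurj : Function.Surjective D.toFlStarGlobal)
  {V : Type} [DecidableEq V] (bad arc : Finset V) (δ : V → D.LocalDatum CG hS)

/-- **THE NF KIT OVER abc-iut-L5-t4's `baseKitThetaNFOfData`** (D-JΘ1-2 (D)): every field of `PMBaseKit.NFKit` is the corresponding field of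
`nfKitOfData` (p451329) transported along `ιThetaNF`/`πThetaNF`; `labPull` reads the transport datum of a morphism.  Binders: the base kit's,
`hNF : Surjective toFlStarNF` (Ex 4.3 (i)), `vemb : V ↪ Val K` (for `valOfV`). ([IUTchI] Def 4.1 (v) p.97) [claim: Mochizuki2012, status: disputed] -/
def nfKitThetaOfData (hNF : Function.Surjective (D.toFlStarNF CG hS)) (vemb : V ↪ Val K) :
    (D.baseKitThetaNFOfData CG hS hsurj bad arc δ).NFKit where
  GlobNF := D.GlobNF
  gnfModel := D.gnfModel
  gnf_iso := D.gnf_iso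
  nfAtV v := (δ v).nfAtVNF ⋙ (δ v).ιThetaNF
  projAt v := (δ v).ιThetaNF.map (δ v).projAtNF
  phiNF v := (δ v).ιThetaNF.map (δ v).phiNFNF
  phiNF_eq v := by
    change (δ v).ιThetaNF.map (δ v).phiNFNF = (δ v).ιThetaNF.map (δ v).phiEllNF ≫ (δ v).ιThetaNF.map (δ v).projAtNF
    rw [← Functor.map_comp, (δ v).phiNFNF_eq]
  Val _ := @Shrink.{0} (Val K) (small_val K)
  valIso _ := Equiv.refl _
  valIso_refl _ := rfl
  valIso_trans _ _ := rfl
  valOfV := ⟨fun x => (@equivShrink (Val K) (small_val K)) (vemb x),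
    (@equivShrink (Val K) (small_val K)).injective.comp vemb.injective⟩
  GLabNF _ := FlStar l
  isTorsor_gLabNF _ := IsTorsor.self
  gLabNFMap b := D.gLabNFMapSlot CG hS b
  gLabNFMap_smul b j c := D.gLabNFMapSlot_smul CG hS b j c
  gLabNFMap_refl Y := D.gLabNFMapSlot_refl CG hS Y
  gLabNFMap_trans b b' := D.gLabNFMapSlot_trans CG hS b b'
  εLab := 1
  exists_aut_smul := (D.exists_aut_smul_iff_surjective CG hS).mpr hNF
  LabStar _ _ := FlStar l
  isTorsor_labStar _ _ := IsTorsor.self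
  labStarIso _ := Equiv.refl _
  labStarIso_smul _ _ _ := rfl
  labStarIso_refl _ := rfl
  labStarIso_trans _ _ := rfl
  ηStar _ _ := 1
  labStarIso_η _ := rfl
  labPull := fun {v} {_X} {_Y} f => (δ v).labPullAmb ((δ v).πThetaNF.map f).hom
  labPull_smul := fun {v} {_X} {_Y} f j c => (δ v).labPullAmb_smul ((δ v).πThetaNF.map f).hom j c
  labPull_pre := fun {v} {X} {_X'} {_Y} a f c =>
    (δ v).labPullAmb_pre ((δ v).nonempty_iso_locObj_of_nonempty_iso_modelThetaNF X.property)
      ((δ v).isoDownNF ((ObjectProperty.ι _).mapIso a)) ((δ v).πThetaNF.map f).hom c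
  labPull_post := fun {v} {X} {_Y} {_Y'} f b c =>
    (δ v).labPullAmb_post ((δ v).nonempty_iso_locObj_of_nonempty_iso_modelThetaNF X.property) ((δ v).πThetaNF.map f).hom b c
  labPull_phiNF_εLab v := (δ v).labPullAmb_phiNFAmb_one

/-! ### Definitional readings -/

/-- The NF kit's isomorphs of `𝒟^⊚` are abc-iut-L5-t3's `GlobNF`. ([IUTchI] Def 4.1 (v) p.97) [claim: Mochizuki2012, status: disputed] -/
theorem nfKitThetaOfData_GlobNF (hNF : Function.Surjective (D.toFlStarNF CG hS)) (vemb : V ↪ Val K) :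
    (D.nfKitThetaOfData CG hS hsurj bad arc δ hNF vemb).GlobNF = D.GlobNF := rfl

/-- `†𝒟^⊚` seen at `v̲` is `ι` of the J-NF-1 object (definitional). ([IUTchI] Def 4.1 (vi) p.98) [claim: Mochizuki2012, status: disputed] -/
theorem nfKitThetaOfData_nfAtV_obj (hNF : Function.Surjective (D.toFlStarNF CG hS)) (vemb : V ↪ Val K) (v : V) (Y : D.GlobNF) :
    ((D.nfKitThetaOfData CG hS hsurj bad arc δ hNF vemb).nfAtV v).obj Y = (δ v).ιThetaNF.obj (((δ v).nfAtVNF).obj Y) := rfl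

/-- `φ^NF_{•,v̲}` of the Θ-NF kit is `ι(φ^NF_{•,v̲})`, an ÉTALE morphism whose transport datum is `xΠ_v̲ ↦ xΠ_{C̲_K}` (definitional).
([IUTchI] Ex 4.3 (ii) p.99) [claim: Mochizuki2012, status: disputed] -/
theorem nfKitThetaOfData_phiNF (hNF : Function.Surjective (D.toFlStarNF CG hS)) (vemb : V ↪ Val K) (v : V) :
    (D.nfKitThetaOfData CG hS hsurj bad arc δ hNF vemb).phiNF v = (δ v).ιThetaNF.map (δ v).phiNFNF := rfl

/-- The transport datum of `φ^NF_{•,v̲}` is `phiNFAmb` (definitional). ([IUTchI] Ex 4.3 (ii) p.99) [claim: Mochizuki2012, status: disputed] -/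
theorem nfKitThetaOfData_phiNF_base_hom (hNF : Function.Surjective (D.toFlStarNF CG hS)) (vemb : V ↪ Val K) (v : V) :
    ((δ v).πThetaNF.map ((D.nfKitThetaOfData CG hS hsurj bad arc δ hNF vemb).phiNF v)).hom = (δ v).phiNFAmb := rfl

/-- `φ^NF_{•,v̲}` of the Θ-NF kit is étale (its tag is `false`). ([IUTchI] Ex 4.3 (ii) p.99) [claim: Mochizuki2012, status: disputed] -/
theorem nfKitThetaOfData_phiNF_deg (hNF : Function.Surjective (D.toFlStarNF CG hS)) (vemb : V ↪ Val K) (v : V) :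
    ((D.nfKitThetaOfData CG hS hsurj bad arc δ hNF vemb).phiNF v).deg = false := rfl

/-- The double covering `𝒟^{⊚±} → 𝒟^⊚` seen at `v̲` is `ι(globCover)` (definitional). ([IUTchI] Def 6.1 (v) p.158) [claim: Mochizuki2012, status: disputed] -/
theorem nfKitThetaOfData_projAt (hNF : Function.Surjective (D.toFlStarNF CG hS)) (vemb : V ↪ Val K) (v : V) :
    (D.nfKitThetaOfData CG hS hsurj bad arc δ hNF vemb).projAt v = (δ v).ιThetaNF.map (δ v).projAtNF := rfl

/-- The label classes of the Θ-NF kit are the canonical labels `𝔽_l^⋇` (Prop 4.2). ([IUTchI] Prop 4.2 p.98) [claim: Mochizuki2012, status: disputed] -/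
theorem nfKitThetaOfData_GLabNF (hNF : Function.Surjective (D.toFlStarNF CG hS)) (vemb : V ↪ Val K)
    (Y : (D.nfKitThetaOfData CG hS hsurj bad arc δ hNF vemb).GlobNF) :
    (D.nfKitThetaOfData CG hS hsurj bad arc δ hNF vemb).GLabNF Y = FlStar l := rfl

/-- `[ε] = 1` in the Θ-NF kit. ([IUTchI] Ex 4.5 (ii) p.108) [claim: Mochizuki2012, status: disputed] -/
theorem nfKitThetaOfData_εLab (hNF : Function.Surjective (D.toFlStarNF CG hS)) (vemb : V ↪ Val K) :
    (D.nfKitThetaOfData CG hS hsurj bad arc δ hNF vemb).εLab = (1 : FlStar l) := rfl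

/-- **The label pull-back of the Θ-NF kit along ANY morphism `X ⟶ †𝒟^⊚` is multiplication by `labPullChar` OF ITS TRANSPORT DATUM**
(definitional). ([IUTchI] Ex 4.5 (i) p.107) [claim: Mochizuki2012, status: disputed] -/
theorem nfKitThetaOfData_labPull_apply (hNF : Function.Surjective (D.toFlStarNF CG hS)) (vemb : V ↪ Val K) {v : V}
    {X : (D.baseKitThetaNFOfData CG hS hsurj bad arc δ).LocalObj v} {Y : (D.nfKitThetaOfData CG hS hsurj bad arc δ hNF vemb).GlobNF}
    (f : X.obj ⟶ ((D.nfKitThetaOfData CG hS hsurj bad arc δ hNF vemb).nfAtV v).obj Y) (c : FlStar l) :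
    (D.nfKitThetaOfData CG hS hsurj bad arc δ hNF vemb).labPull f c = (δ v).labPullChar ((δ v).πThetaNF.map f).hom * c := rfl

/-- **On ÉTALE morphisms the Θ-NF kit's label pull-back IS the J-NF-1 kit's** (`nfKitOfData_labPull_apply`, p451329): for `f` a morphism of the
NF-widened Π-ambient, `labPull (ι f) = labPull f` (definitional, `π (ι f) = f`). ([IUTchI] Ex 4.5 (i) p.107) [claim: Mochizuki2012, status: disputed] -/
theorem nfKitThetaOfData_labPull_ι (hNF : Function.Surjective (D.toFlStarNF CG hS)) (vemb : V ↪ Val K) {v : V}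
    {X : (D.baseKitThetaNFOfData CG hS hsurj bad arc δ).LocalObj v} {Y : D.GlobNF}
    (f : X.obj.toFull ⟶ ((δ v).nfAtVNF).obj Y) (c : FlStar l) :
    (D.nfKitThetaOfData CG hS hsurj bad arc δ hNF vemb).labPull (X := X) (Y := Y) ((δ v).ιThetaNF.map f) c =
      (δ v).labPullAmb f.hom c := rfl

/-- **The interface `NFKit` is INHABITED over the Θ-NF kit** (given `hNF`, `vemb`). ([IUTchI] Def 4.1 (v) p.97) [claim: Mochizuki2012, status: disputed] -/
theorem nonempty_nfKit_baseKitThetaNFOfData (hNF : Function.Surjective (D.toFlStarNF CG hS)) (vemb : V ↪ Val K) :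
    Nonempty (D.baseKitThetaNFOfData CG hS hsurj bad arc δ).NFKit :=
  ⟨D.nfKitThetaOfData CG hS hsurj bad arc δ hNF vemb⟩

end OfData

end InitialThetaData

end NFKitTheta

end Literature.IUT.HodgeTheaters
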